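import Summits.ABC.IUTFork.Cor312VolumesRealAssembly
import HarnessLib

/-!
# [IUTchIII] Cor. 3.12, TEAM B — container-preserving realisations BY MULTIPLICATION: norm-one
# twists preserve the verbatim container of the real prime packets

Record-only file (D-0012) of the abc-iut cell (Cor. 3.12 strategy TEAM B «estimate / log-Kummer» of
HUMAN RULING D-0067 (3), seat abc-iut-c312-12 = B2, gen 2); PROOF-ONLY; TAKES NO SIDE. The capstone at
the assembled real setting (`Cor312TeamBCapstoneRealDH`) consumes Kummer-realisation data: maps
`Ψ_m` with `SummandPieces.PreservesRegions` realising the `m`-th Kummer isomorphisms on the verbatim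
container. [IUTchIII] Prop. 3.1 (ii) (p. 92: the Kummer isomorphisms are compatible with the integral
structures) and Dupuy–Hilado §4.7 ("fixes the lattice") say the PRINTED realisations act by
integral-structure-compatible twists; on the real prime packets
`X_{v⃗} = K_{v_0} ⊗_{ℚ_p} ⋯ ⊗_{ℚ_p} K_{v_j}` the basic such twists are MULTIPLICATIONS by elements all
of whose `ψ`-components have norm one (products of slot-wise unit twists `ι_i(u)`, `u ∈ 𝒪^×_{K_v}`).
This file PROVES they preserve the container — the multiplicative companion of abc-iut-c312-5's
(Ind1)/(Ind2) machinery (`perm_preserves`/`strip_preserves`/`ism_preserves`), in the same `∃ Ψ,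
PreservesRegions ∧ (action pinned)` shape:

* `Cor312Vol.exists_mulEquiv_of_ne` — multiplication by `g` with nondegenerate `ψ`-components is a
  bijection of the packet algebra (`g` is a unit: transport `unitOfNe` along `ψ = dEquiv`).
* `Cor312Vol.packetAdm_smul_iff` / `packetLogμ_smul_of_norm_one` — nondegenerate translates preserve
  admissibility both ways ([AbsTopIII] Prop. 5.7 (i)(b) via `packetVol_smul`), and NORM-ONE translates
  preserve the log-measure exactly (`log μ̄(g·A) = Σ_j (e_j f_j/D)·log ‖ψ(g)_j‖ + log μ̄(A)` with every
  `log ‖ψ(g)_j‖ = log 1 = 0` — [IUTchIV] Prop. 1.4 (iii) p. 14).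
* `Cor312Vol.PadicPresentation.mul_preserves` — summand-wise multiplication by norm-one-component
  elements `g_{v⃗}` preserves the verbatim local pieces at `v_ℚ = p`:
  `∃ Ψ, P.toLocalPieces.PreservesRegions j Ψ ∧ ∀ y v⃗, Ψ y v⃗ = g_{v⃗} · y_{v⃗}`.
* `Cor312Vol.PadicPresentation.mul_preserves_iota` — the concrete Prop. 3.1 (ii) shape: a slot-wise
  unit twist (`u_v ∈ K_v` of norm one at tensor slot `i₀`, embedded by `ι_{i₀}`) preserves the
  container (the `ψ`-components of `ι_{i₀}(u)` have norm `‖u‖ = 1`: `norm_dEquiv_iota`).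
* `Thm311.Real.exists_preservesRegions_mul_summandPiecesDH` / `preservesRegions_id_summandPiecesDH_arch`
  — the assembly: at `v_ℚ = p` the above gives `(summandPiecesDH X hlog).PreservesRegions j (.inr pp)`
  with the action pinned (`preservesRegions_ofLocal_iff`); at `v_ℚ = ∞` the identity preserves the
  trivial container (the assembly's recorded Dupuy–Hilado convention).

Consumers: the `hΨ` hypothesis of `Cor312TeamBCapstoneRealDH` (and of p413800/p414562's instance data)
holds for ANY family of norm-one-component multiplicative realisations — the residual instance claim
(WHICH twists realise the PRINTED Kummer isomorphisms: abc-iut-c312-3 W2-G / c312-5 `Real.*`) is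
deliberately NOT taken here. Sources read on the page (kurims `paper:url-4b091feeb646`): [IUTchIII]
p. 92 (Prop. 3.1 (ii)), pp. 94–96 (Rmk. 3.1.1 (ii)(iii)), pp. 155–156 (Thm. 3.11 (ii));
[IUTchIV] Prop. 1.4 (i)(iii) pp. 13–14. [claim: Mochizuki2012, status: disputed]
[cite: DupuyHilado2025, §4.7] NO new definition, NO new `Prop`; no judgement on Cor. 3.12.
-/

noncomputable section

open Set Function NumberField
open scoped Pointwise

namespace Summit.ABC

namespace IUTFork

namespace Cor312Vol

open Thm311 Literature.IUT.LogThetaLattice Literature.IUT.LogVolume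

/-! ## 1. Multiplication by nondegenerate / norm-one elements of a packet algebra -/

section PacketMul

variable (p : ℕ) [Fact p.Prime]
variable {I : Type} [Fintype I] [DecidableEq I]
variable (k : I → Type) [∀ i, NontriviallyNormedField (k i)] [∀ i, NormedAlgebra ℚ_[p] (k i)]
  [∀ i, IsUltrametricDist (k i)] [∀ i, ProperSpace (k i)]

omit [DecidableEq I] [∀ i, IsUltrametricDist (k i)] in
/-- **Multiplication by a `ψ`-nondegenerate element is a bijection** of the packet algebra
`V = K_{v_0} ⊗_{ℚ_p} ⋯ ⊗_{ℚ_p} K_{v_j}` (such a `g` is a unit: its image under the decomposition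
`ψ : V ≃ Π_j L_j` has all components nonzero, hence invertible componentwise).
[cite: MochizukiAbsTopIII2015, Prop. 5.7 (i)(b) p. 138] -/
theorem exists_mulEquiv_of_ne (g : PacketAlgebra p k) (hg : ∀ j, dEquiv p k g j ≠ 0) :
    ∃ ψ : PacketAlgebra p k ≃ PacketAlgebra p k, ∀ x, ψ x = g * x := by
  refine ⟨⟨fun x => g * x,
    fun x => (dEquiv p k).symm
      (((unitOfNe p k (dEquiv p k g) hg)⁻¹ : (DSum p k)ˣ) * dEquiv p k x),
    fun x => ?_, fun x => ?_⟩, fun _ => rfl⟩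
  · show (dEquiv p k).symm
        (((unitOfNe p k (dEquiv p k g) hg)⁻¹ : (DSum p k)ˣ) * dEquiv p k (g * x)) = x
    have h1 : (((unitOfNe p k (dEquiv p k g) hg)⁻¹ : (DSum p k)ˣ) : DSum p k) *
        dEquiv p k g = 1 := Units.inv_mul _
    rw [map_mul (dEquiv p k) g x, ← mul_assoc, h1, one_mul, AlgEquiv.symm_apply_apply]
  · show g * (dEquiv p k).symm
        (((unitOfNe p k (dEquiv p k g) hg)⁻¹ : (DSum p k)ˣ) * dEquiv p k x) = x
    apply (dEquiv p k).injective
    have h2 : dEquiv p k g *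
        (((unitOfNe p k (dEquiv p k g) hg)⁻¹ : (DSum p k)ˣ) : DSum p k) = 1 := Units.mul_inv _
    rw [map_mul (dEquiv p k), AlgEquiv.apply_symm_apply, ← mul_assoc, h2, one_mul]

omit [DecidableEq I] [∀ i, IsUltrametricDist (k i)] in
/-- A norm-one-component element is `ψ`-nondegenerate. [folklore] -/
theorem components_ne_zero_of_norm_one (g : PacketAlgebra p k)
    (hg1 : ∀ j, ‖dEquiv p k g j‖ = 1) : ∀ j, dEquiv p k g j ≠ 0 := fun j h0 => by
  have h := hg1 j
  rw [h0, norm_zero] at h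
  exact zero_ne_one h

variable [Nonempty I]

/-- **Nondegenerate translates preserve admissibility both ways** ("compact subsets of positive
measure" go to such under `x ↦ g·x` and back) — the two directions of [AbsTopIII] Prop. 5.7 (i)(b) /
Dupuy–Hilado §3.7 as one `Iff`. [cite: DupuyHilado2025, §3.7] -/
theorem packetAdm_smul_iff (g : PacketAlgebra p k) (hg : ∀ j, dEquiv p k g j ≠ 0)
    {A : Set (PacketAlgebra p k)} : PacketAdm p k (g • A) ↔ PacketAdm p k A :=
  ⟨packetAdm_of_smul p k g hg, packetAdm_smul p k g hg⟩

/-- The normalising polydisc translated by a NORM-ONE-component element keeps log-measure `0`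
(`log μ̄(g·(R_I)^∼) = Σ_j (e_j f_j/D)·log ‖ψ(g)_j‖ = 0`). [cite: Mochizuki2012, IUTchIV Prop. 1.4
(iii) proof p. 14] -/
theorem packetLogμ_smul_normalizedPacket_of_norm_one (g : PacketAlgebra p k)
    (hg1 : ∀ j, ‖dEquiv p k g j‖ = 1) :
    packetLogμ p k (g • (normalizedPacket p k : Set (PacketAlgebra p k))) = 0 := by
  rw [packetLogμ_smul_normalizedPacket p k g (components_ne_zero_of_norm_one p k g hg1)]
  refine Finset.sum_eq_zero fun j _ => ?_
  rw [hg1 j, Real.log_one, mul_zero, mul_zero]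

/-- **Norm-one translates preserve the log-measure exactly**: `log μ̄(g·A) = log μ̄(A)` for admissible
`A` and `g` with all `ψ`-components of norm one — the measure-preservation the integral-structure
compatibility of the Kummer isomorphisms ([IUTchIII] Prop. 3.1 (ii)) buys on the real summands.
[cite: DupuyHilado2025, §3.7] -/
theorem packetLogμ_smul_of_norm_one (g : PacketAlgebra p k) (hg1 : ∀ j, ‖dEquiv p k g j‖ = 1)
    {A : Set (PacketAlgebra p k)} (hA : PacketAdm p k A) :
    packetLogμ p k (g • A) = packetLogμ p k A := by
  rw [packetLogμ_smul p k g (components_ne_zero_of_norm_one p k g hg1) hA,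
    packetLogμ_smul_normalizedPacket_of_norm_one p k g hg1, zero_add]

end PacketMul

/-! ## 2. Summand-wise multiplicative realisations preserve the verbatim local pieces at `v_ℚ = p` -/

namespace PadicPresentation

variable {T : ThetaIndex} {L : LogShells T} {vQ : T.VQ} {p : ℕ} [Fact p.Prime]
  (P : PadicPresentation L vQ p) {j : T.Label}

/-- **Summand-wise multiplication by norm-one-component elements preserves the verbatim container**
at `v_ℚ = p`: for `g_{v⃗} ∈ X_{v⃗}` with all `ψ`-components of norm one there is a container-preserving
`Ψ` acting as `(Ψ y)_{v⃗} = g_{v⃗} · y_{v⃗}` — the multiplicative companion of `perm_preserves` /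
`ism_preserves`, in the shape the Kummer-realisation hypotheses of the capstones consume.
[cite: DupuyHilado2025, §4.7] [claim: Mochizuki2012, status: disputed] -/
theorem mul_preserves (g : ∀ e : T.Caps j → T.Fibre vQ, P.X e)
    (hg1 : ∀ (e : T.Caps j → T.Fibre vQ) (jj : DIdx p (P.kk e)), ‖dEquiv p (P.kk e) (g e) jj‖ = 1) :
    ∃ Ψ, P.toLocalPieces.PreservesRegions j Ψ ∧
      ∀ (y : ∀ e : T.Caps j → T.Fibre vQ, P.X e) (e : T.Caps j → T.Fibre vQ), Ψ y e = g e * y e := by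
  classical
  haveI : Nonempty (T.Caps j) := ⟨0⟩
  choose ψ hψ using fun e => exists_mulEquiv_of_ne p (P.kk e) (g e)
    (components_ne_zero_of_norm_one p (P.kk e) (g e) (hg1 e))
  have himg : ∀ (e : T.Caps j → T.Fibre vQ) (R : Set (P.X e)), ψ e '' R = g e • R := by
    intro e R
    rw [show ⇑(ψ e) = fun x => g e * x from funext (hψ e)]
    simp only [← smul_eq_mul, Set.image_smul]
  refine ⟨Pi.map fun e => ⇑(ψ e),
    LocalPieces.PreservesRegions.summandwise P.toLocalPieces ψ (fun e R => ?_) (fun e R hR => ?_),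
    fun y e => hψ e (y e)⟩
  · show PacketAdm p (P.kk e) (ψ e '' R) ↔ PacketAdm p (P.kk e) R
    rw [himg e R]
    exact packetAdm_smul_iff p (P.kk e) (g e)
      (components_ne_zero_of_norm_one p (P.kk e) (g e) (hg1 e))
  · show packetLogμ p (P.kk e) (ψ e '' R) = packetLogμ p (P.kk e) R
    rw [himg e R]
    exact packetLogμ_smul_of_norm_one p (P.kk e) (g e) (hg1 e) hR

/-- **The concrete [IUTchIII] Prop. 3.1 (ii) shape: slot-wise UNIT TWISTS preserve the verbatim
container.** A family of norm-one elements `u_v ∈ K_v` embedded at one tensor slot `i₀` by the factor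
embedding `ι_{i₀}` multiplies each summand `X_{v⃗}` by `ι_{i₀}(u_{v⃗(i₀)})`, whose `ψ`-components all
have norm `‖u_{v⃗(i₀)}‖ = 1` (the factor embeddings are isometric, `norm_dEquiv_iota`) — so the twist
is container-preserving with its action pinned. [claim: Mochizuki2012, status: disputed] -/
theorem mul_preserves_iota (i₀ : T.Caps j) (u : ∀ v : T.Fibre vQ, P.k v)
    (hu : ∀ v, ‖u v‖ = 1) :
    ∃ Ψ, P.toLocalPieces.PreservesRegions j Ψ ∧
      ∀ (y : ∀ e : T.Caps j → T.Fibre vQ, P.X e) (e : T.Caps j → T.Fibre vQ),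
        Ψ y e = iota p (P.kk e) i₀ (u (e i₀)) * y e := by
  classical
  exact P.mul_preserves (fun e => iota p (P.kk e) i₀ (u (e i₀))) fun e jj => by
    rw [norm_dEquiv_iota p (P.kk e) i₀ (u (e i₀)) jj]
    exact hu (e i₀)

end PadicPresentation

end Cor312Vol

/-! ## 3. The assembly over all places: `summandPiecesDH` -/

namespace Thm311

namespace Real

open Cor312Vol Literature.IUT.LogThetaLattice Literature.IUT.LogVolume

variable {F : Type} [Field F] [NumberField F] (X : PilotData F) {logv : PadicLogs F}
  (hlog : LogvAnalytic logv)

/-- **Norm-one multiplicative realisations preserve the assembled verbatim container at `v_ℚ = p`**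
(`preservesRegions_ofLocal_iff` of `mul_preserves`): the `hΨ` obligation of the capstone at the
assembled real setting (`Cor312TeamBCapstoneRealDH`) holds at the nonarchimedean places for any
family of norm-one-component multiplications, with the action pinned. The `Fact` instance is
`⟨pp.2⟩`. [claim: Mochizuki2012, status: disputed] -/
theorem exists_preservesRegions_mul_summandPiecesDH {j : (thetaIndex X).Label}
    (pp : Nat.Primes) [Fact (pp : ℕ).Prime]
    (g : ∀ e : (thetaIndex X).Caps j → (thetaIndex X).Fibre (.inr pp),
      (padicPresentationDH X pp.1 logv (hlog pp)).X e)
    (hg1 : ∀ (e : (thetaIndex X).Caps j → (thetaIndex X).Fibre (.inr pp))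
      (jj : DIdx pp.1 ((padicPresentationDH X pp.1 logv (hlog pp)).kk e)),
      ‖dEquiv pp.1 ((padicPresentationDH X pp.1 logv (hlog pp)).kk e) (g e) jj‖ = 1) :
    ∃ Ψ, (summandPiecesDH X hlog).PreservesRegions j (.inr pp) Ψ ∧
      ∀ (y : ∀ e : (thetaIndex X).Caps j → (thetaIndex X).Fibre (.inr pp),
        (padicPresentationDH X pp.1 logv (hlog pp)).X e)
        (e : (thetaIndex X).Caps j → (thetaIndex X).Fibre (.inr pp)), Ψ y e = g e * y e := by
  obtain ⟨Ψ, hΨ, hact⟩ := (padicPresentationDH X pp.1 logv (hlog pp)).mul_preserves g hg1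
  exact ⟨Ψ, (SummandPieces.preservesRegions_ofLocal_iff (localPiecesDH X hlog) Ψ).2 hΨ, hact⟩

/-- At the archimedean place the assembled container is the trivial one (the recorded Dupuy–Hilado
convention), and the IDENTITY preserves it — the `hΨ` obligation of the capstone at `v_ℚ = ∞` is
dischargeable by `Ψ := id`. [cite: DupuyHilado2025, §3] -/
theorem preservesRegions_id_summandPiecesDH_arch (u : Unit) (j : (thetaIndex X).Label) :
    (summandPiecesDH X hlog).PreservesRegions j (.inl u) _root_.id :=
  (SummandPieces.preservesRegions_ofLocal_iff (localPiecesDH X hlog) _root_.id).2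
    (LocalPieces.preservesRegions_trivial_id (logShellsDH X logv) (.inl u) j)

end Real

end Thm311

end IUTFork

end Summit.ABC

end
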